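import Mathlib
import HarnessLib
import Literature.MathematicalPhysics.StatisticalMechanics.LinearisedMapABKMContractionGain
import Literature.MathematicalPhysics.StatisticalMechanics.FluctuationSmooth
import Literature.MathematicalPhysics.StatisticalMechanics.RenormalisationMapZero

/-!
# [ABKM19] Lemma 10.2 for the torus data: the large part `F(U) = Σ_{X ∈ 𝒫_k^c∖ℬ_k, π(X)=U} R_{k+1}K(X)`
# of the linearised map satisfies `‖F‖_{k+1}^{(A)} ≤ ε(A)‖K‖_k^{(A)}`

`LinearisedMapLargePartNorm.tayNormLE_largePart_fluct` is Lemma 10.2 for abstract norm parameters `P`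
(hypotheses: the integration property, (w6), the gauge scale relations, the closure gain).  This file
discharges all of them for the concrete torus tower (`abkmNormParams`, `M = L^N`, `L` odd,
`L ≥ 2^{d+3} + 16R`, `AbkmWeightBounds` with integration constant `A_𝒫`, closure gain
`η(d) = 1 + (2(2^d+1)+6)^{−d}` from Brydges' Lemma 6.15 `closureGain_pow`), exactly as
`LinearisedMapABKMContractionGain.weakNormLE_opC_abkm_gain` does for Lemma 10.1, and removes the
hypothesis "`R_{k+1}K(X)` is `C^{r₀}` for every `X`" (only connected `X` matter, where it follows from
the weak norm, `FluctuationSmooth.contDiff_fluct_of_weakNormLE`).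

* **`tayNormLE_largePart_fluct_abkm`** — for a non-empty `(k+1)`-polymer `U` and `‖K‖_k^{(A)} ≤ C`:
  `|F(U)|_{T_{k+1}^{U*}, w_{k+1}^U} ≤ C · ε(A) · A^{−|U|_{k+1}}`, `ε = largePartEps d L A A_𝒫 η(d)`.

The large part is the piece of `C_kK` added back into the second remainder sum `Σ₂ᴸ` of the Lipschitz
estimate of the renormalisation map (RenormalisationMapRemainderTwoLarge); this bound pays for it.

Everything is proved; no named fact.

## References
* S. Adams, S. Buchholz, R. Kotecký, S. Müller, arXiv:1910.13564, Lemma 10.2 [AdamsBuchholzKoteckyMuller2019].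
* D. C. Brydges, IAS/Park City Math. Ser. 16 (2009), Lemma 6.15 [Brydges2009].
-/

noncomputable section

namespace Literature.MathematicalPhysics.StatisticalMechanics.GradientRG

open scoped BigOperators Classical
open Finset Matrix
open Literature.MathematicalPhysics.StatisticalMechanics.TorusPolymer
  (IsPolymer blocks blockOf thicken reblock closure mem_blocks numBlocks isPolymer_blockOf card_blocks_eq_numBlocks)
open Literature.Barriers.CriticalPhenomena.LongRangePhi4.Polymer (IsConn)
open Literature.MathematicalPhysics.QuantumFieldTheory

variable {d M : ℕ} [NeZero M]

/-- **[ABKM19] Lemma 10.2 for the torus data** (module docstring): `d ≥ 3`, `L` odd, `L ≥ 2^{d+3}+16R`,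
`M = L^N`, `k+1 ≤ N`, `θ̄, λ > 0`, `AbkmWeightBounds` (`A_𝒫 ≥ 0`), `h > 0`, `1 ≤ A`, `A_𝒫 ≤ A`,
`2^{L^d} A_𝒫 A^{−(1−1/η(d))} ≤ 1`; `K` with `‖K‖_k^{(A)} ≤ C`, `C^{r₀}`, local on connected polymers; `U` a
non-empty `(k+1)`-polymer. [cite: AdamsBuchholzKoteckyMuller2019, Lemma 10.2] -/
theorem tayNormLE_largePart_fluct_abkm {L N Mord R n p r₀ : ℕ} {θbar lam μ δ₁ δ₀ A𝒫 h A : ℝ}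
    {𝒞 : ℕ → (Fin d → ZMod M) → ℝ} (hd : 3 ≤ d) (hLodd : Odd L) (hL : 2 ^ (d + 3) + 16 * R ≤ L)
    (hM : M = L ^ N) {k : ℕ} (hkN : k + 1 ≤ N) (hθbar : 0 < θbar) (hlam : 0 < lam)
    (hB : AbkmWeightBounds L N Mord R n θbar lam μ δ₁ δ₀ A𝒫 𝒞
      (abkmWeightData L N Mord R θbar (schedDelta δ₀ δ₁ N) 𝒞))
    (hh : 0 < h) (hA𝒫 : 0 ≤ A𝒫) (hA : 1 ≤ A) (hA𝒫A : A𝒫 ≤ A)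
    (hsmall : (2 : ℝ) ^ (L ^ d) * (A𝒫 * A ^ (-(1 - (1 + 1 / ((2 * (2 ^ d + 1) + 6 : ℝ) ^ d))⁻¹) : ℝ)) ≤ 1)
    {K : Finset (Fin d → ZMod M) → ((Fin d → ZMod M) → ℝ) → ℂ} {C : ℝ} (hC : 0 ≤ C)
    (hK : WeakNormLE (abkmNormParams L N Mord R p r₀ h θbar A (schedDelta δ₀ δ₁ N) 𝒞) k K C)
    (hKd : ∀ X, ContDiff ℝ r₀ (K X))
    (hKloc : ∀ X, IsPolymer (L ^ k) X → IsConn X →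
      IsGaugeLocal ((abkmNormParams L N Mord R p r₀ h θbar A (schedDelta δ₀ δ₁ N) 𝒞).gauge k X) (K X))
    {U : Finset (Fin d → ZMod M)} (hU : IsPolymer (L ^ (k + 1)) U) (hUne : U.Nonempty) :
    TayNormLE ((abkmNormParams L N Mord R p r₀ h θbar A (schedDelta δ₀ δ₁ N) 𝒞).gauge (k + 1) U) r₀
      ((abkmWeightData L N Mord R θbar (schedDelta δ₀ δ₁ N) 𝒞).weight (k + 1) U)
      (largePart (L ^ k) L (fluct (𝒞 (k + 1))) K U)
      (C * largePartEps d L A A𝒫 (1 + 1 / ((2 * (2 ^ d + 1) + 6 : ℝ) ^ d)) *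
        (abkmNormParams L N Mord R p r₀ h θbar A (schedDelta δ₀ δ₁ N) 𝒞).aFactor (k + 1) U) := by
  set P := abkmNormParams L N Mord R p r₀ h θbar A (schedDelta δ₀ δ₁ N) 𝒞 with hP
  -- sizes
  have h8 : 8 ≤ 2 ^ (d + 3) := by
    calc 8 = 2 ^ 3 := by norm_num
      _ ≤ 2 ^ (d + 3) := Nat.pow_le_pow_right (by norm_num) (by omega)
  have h2dle : 2 ^ d ≤ 2 ^ (d + 3) := Nat.pow_le_pow_right (by norm_num) (by omega)
  have hL4 : 4 ≤ L := by omega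
  have h2dlt : 2 ^ d < 2 ^ (d + 3) := Nat.pow_lt_pow_right (by norm_num) (by omega)
  have hL2 : 2 ^ d + 1 ≤ L := by omega
  have hLR : 2 ^ d + R ≤ L := by omega
  have hL0 : (0 : ℝ) < L := by exact_mod_cast hLodd.pos
  have hA0 : 0 < A := by linarith
  have hk1 : k + 1 ≤ N + 1 := by omega
  have hMo : Odd M := by rw [hM]; exact hLodd.pow
  -- the torus at scale `k + 1`
  obtain ⟨t, ht⟩ : ∃ t, N = (k + 1) + t := ⟨N - (k + 1), by omega⟩
  have hMt : M = P.L ^ (k + 1) * L ^ t := by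
    show M = L ^ (k + 1) * L ^ t
    rw [← pow_add, ← ht]; exact hM
  have htodd : Odd (L ^ t) := hLodd.pow
  -- gauges of the two scales
  have h𝔥k : 0 < P.𝔥 k := fieldWt_pos hh hL0 d k
  have h𝔥 : 0 < P.𝔥 (k + 1) := fieldWt_pos hh hL0 d (k + 1)
  have hsucc : P.𝔥 (k + 1) = scaleRatio d L * P.𝔥 k := fieldWt_succ_nat hLodd.pos d k
  have h𝔥le : P.𝔥 (k + 1) ≤ P.𝔥 k := by
    rw [hsucc]; exact mul_le_of_le_one_left h𝔥k.le (scaleRatio_le_one hd hL4)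
  have hR : 0 < P.R k := by show (0 : ℝ) < (L : ℝ) ^ k; positivity
  have hRle : P.R k ≤ P.R (k + 1) := by
    show (L : ℝ) ^ k ≤ (L : ℝ) ^ (k + 1)
    exact pow_le_pow_right₀ (by exact_mod_cast hLodd.pos) (by omega)
  have hrad : P.rad k ≤ P.rad (k + 1) := starRad_le_succ hLR k
  have hrad' : P.rad k + (2 ^ d - 1) * P.L ^ k ≤ P.rad (k + 1) := starRad_add_le_succ hLR k
  have hη : (0 : ℝ) < 1 + 1 / ((2 * (2 ^ d + 1) + 6 : ℝ) ^ d) := by positivity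
  -- the discharged hypotheses
  have hw6 : NextWeightDominates P k := nextWeightDominates_abkm hB hLodd hLR hMt htodd p r₀ h A
  have hint : IntegrationProperty P k (𝒞 (k + 1)) A𝒫 := integrationProperty_abkm hθbar hlam hB hk1 p r₀ h A
  have hgain : ∀ X : Finset (Fin d → ZMod M), IsPolymer (P.L ^ k) X → IsConn X →
      2 ^ d < (blocks (P.L ^ k) X).card →
        (1 + 1 / ((2 * (2 ^ d + 1) + 6 : ℝ) ^ d)) *
          ((blocks (P.L * P.L ^ k) (closure (P.L * P.L ^ k) X)).card : ℝ) ≤ (blocks (P.L ^ k) X).card :=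
    fun X hX hc hl => closureGain_pow hLodd hL2 hL4 hM hkN hX hc hl
  -- restrict `K` to connected `k`-polymers (the large part only reads those)
  set K' : Finset (Fin d → ZMod M) → ((Fin d → ZMod M) → ℝ) → ℂ :=
    fun X => if IsPolymer (L ^ k) X ∧ IsConn X then K X else 0 with hK'def
  have hK'eq : ∀ X, IsPolymer (L ^ k) X → IsConn X → K' X = K X := fun X hX hc => by
    show (if IsPolymer (L ^ k) X ∧ IsConn X then K X else 0) = K X
    exact if_pos ⟨hX, hc⟩
  have hK' : WeakNormLE P k K' C := fun X hX hc => by rw [hK'eq X hX hc]; exact hK X hX hc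
  have hK'd : ∀ X, ContDiff ℝ P.r₀ (K' X) := fun X => by
    by_cases hX : IsPolymer (L ^ k) X ∧ IsConn X
    · simp only [hK'def, if_pos hX]; exact hKd X
    · simp only [hK'def, if_neg hX]; exact contDiff_const
  have hK'loc : ∀ X, IsPolymer (P.L ^ k) X → IsConn X → IsGaugeLocal (P.gauge k X) (K' X) :=
    fun X hX hc => by rw [hK'eq X hX hc]; exact hKloc X hX hc
  have hR'd : ∀ X, ContDiff ℝ P.r₀ (fluct (𝒞 (k + 1)) (K' X)) := fun X => by
    by_cases hX : IsPolymer (L ^ k) X ∧ IsConn X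
    · rw [hK'eq X hX.1 hX.2]
      exact contDiff_fluct_of_weakNormLE hθbar hlam hB hk1 hA0 hC hK hKd hKloc hX.1 hX.2
    · have : K' X = 0 := by simp only [hK'def, if_neg hX]
      rw [this]
      have h0 : fluct (𝒞 (k + 1)) (0 : ((Fin d → ZMod M) → ℝ) → ℂ) = fun _ => 0 := fluct_const _ 0
      rw [h0]; exact contDiff_const
  have hlp : largePart (L ^ k) L (fluct (𝒞 (k + 1))) K U = largePart (L ^ k) L (fluct (𝒞 (k + 1))) K' U := by
    funext φ
    unfold largePart
    refine sum_congr rfl fun X hX => ?_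
    obtain ⟨hXp, hXc, -, -⟩ := mem_largePartIndex.1 hX
    rw [hK'eq X hXp hXc]
  rw [hlp]
  exact tayNormLE_largePart_fluct P hMt hLodd htodd h𝔥 h𝔥le hR hRle hrad hrad' hA hA𝒫 hA𝒫A hη hsmall hgain
    hint hw6 hC hK' hK'd hK'loc hR'd hU hUne

end Literature.MathematicalPhysics.StatisticalMechanics.GradientRG

end
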